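import Summits.PneNP.PneNP.Theorems.SoloBlindStreamingFoolingLinear
import Literature.Computability.Complexity.PaulPippengerSzemerediTrotter1983Blocks
import HarnessLib

/-!
# THEOREM F♭: sublinear update time alone excludes `SAT` from uniform one-pass streaming — the
# halting rule makes update time a space bound

THEOREM F♯ (`SoloBlindStreamingFoolingLinear`) proved `SAT ∉ USTREAM S T` for every update time
`T` as soon as the SPACE bound satisfies `(8m+9) · S N < m · N` eventually.  This file proves the
complementary TIME-ONLY fragment of the summit's streaming family
(`PneNP ↔ ∀ k, SAT ∉ USTREAM (N^k + k) (N^k + k)`, THEOREM E): for EVERY space bound `S`,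

* `SAT_not_mem_USTREAM_of_sublinear_time`: if `C · T N < N` eventually for every constant `C`
  (i.e. `T = o(N)`), then `SAT ∉ USTREAM S T`.

The mechanism is a bookkeeping fact of the machine model, recorded here as a kernel lemma because
it governs how the typed family should be read (and corrects an informal remark of the
accompanying report, which had assumed one `pop` per `TM2` step): a `TM2` statement is a finite
tree and pops at most `TM2Comp.popBound` symbols of any stack when executed, so a `FinTM2` pops at
most `TM2Comp.machinePopBound` symbols per step (the tree's `TM2Comp.length_step_ge`, from the
PPST 1983 toolkit), hence at most `machinePopBound · n` in `n` steps (`length_iterate_ge`), and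
since Mathlib's halting convention `haltList` requires the input stack to be consumed, a machine
that outputs `l'` on input `l` within `m` steps satisfies the HALTING RULE
`l.length ≤ l'.length + machinePopBound · m` (`length_le_of_tm2OutputsInTime`; the mirror image of
the tree's output-length bound `TM2Comp.length_le_of_outputsWithin`).  For a uniform streaming
algorithm the update machine receives `⟨bin N, ⟨σ, b⟩⟩` (length `≥ 2|σ|`) and the report machine
`⟨bin N, σ_final⟩`, so every reached state has `|σ| ≤ D · T N` with `D` the larger pop bound of the
two machines (`exists_length_reach_le_mul`): uniform update/report time `T` entails space `D · T`
on runs, for a MACHINE-DEPENDENT constant `D` — in particular at the level `k = 1` of the summit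
family (`S = T = N + 1`) the whole linear-size state is usable (take a machine with `D ≥ 3`), and
no constant-factor loss is imposed by the pair code.  THEOREM F♯ applied to the space bound `D · T`
then gives the headline.  READING: together with F♯ the decided part of the `(S, T)`-plane of the
family is `{S < (1/8 − δ) N} ∪ {T = o(N)}`, for all uniform one-pass algorithms; the first point of
the summit family, `(N+1, N+1)`, lies outside both strips by constant factors only (8 in space,
any `ω(1)` in time), and nothing information-theoretic separates it from them.

References: S. Arora, B. Barak, *Computational Complexity: A Modern Approach* (2009), §1.2 (running
time counts elementary steps; the input must be read); Mathlib
`Mathlib/Computability/TuringMachine/StackTuringMachine.lean` (`Turing.TM2.stepAux`) and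
`Mathlib/Computability/TMComputable.lean` (`Turing.haltList`, `Turing.TM2OutputsInTime`);
D. M. McKay, C. D. Murray, R. R. Williams, STOC 2019, §2 (the streaming model).
-/

namespace Summit.PneNP.PneNP.Theorems.SoloBlind

open Computability Function Turing
open Literature.Computability.Complexity Literature.Computability.MetaComplexity
open Literature.Computability.MetaComplexity.McKayMurrayWilliams2019
open Literature.Computability.Complexity.TM2Comp (iterate_bind_succ iterate_bind_none initList_eq
  haltList_eq length_update_bot_le popBound machinePopBound length_step_ge)

/-! ### Pops along a run; the halting rule -/

/-- Induction along an `n`-step run for a quantity that SHRINKS by at most `D` per step.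
[folklore] -/
theorem iterate_bind_ge {α : Type*} (f : α → Option α) (φ : α → ℕ) (D : ℕ)
    (H : ∀ c d, f c = some d → φ c ≤ φ d + D) (n : ℕ) :
    ∀ c d, (flip bind f)^[n] (some c) = some d → φ c ≤ φ d + D * n := by
  induction n with
  | zero =>
    intro c d h
    simp only [iterate_zero, id_eq, Option.some.injEq] at h
    simp [h]
  | succ n ih =>
    intro c d h
    rw [iterate_bind_succ] at h
    cases hfc : f c with
    | none => rw [hfc, iterate_bind_none] at h; cases h
    | some c' =>
      rw [hfc] at h
      have h1 := H c c' hfc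
      have h2 := ih c' d h
      rw [Nat.mul_succ]
      omega

/-- `n` steps of a `FinTM2` shorten each stack by at most `machinePopBound * n` symbols (the
pop-side companion of `TM2Comp.length_iterate_le`). [folklore] -/
theorem length_iterate_ge (tm : FinTM2) (k : tm.K) (n : ℕ) (c d : tm.Cfg)
    (h : (flip bind tm.step)^[n] (some c) = some d) :
    (c.stk k).length ≤ (d.stk k).length + machinePopBound tm * n :=
  iterate_bind_ge tm.step (fun c => (c.stk k).length) (machinePopBound tm)
    (fun c d hcd => length_step_ge tm c d hcd k) n c d h

/-- **The halting rule (input length bound).** A `FinTM2` that halts with output word `l'` on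
input word `l` within `m` steps has read its input: `l.length ≤ l'.length + machinePopBound · m`
(Mathlib's `haltList` leaves only the output stack non-empty, so the input stack was popped — or,
if input and output stack coincide, turned into the output).  Pop-side mirror image of
`TM2Comp.length_le_of_outputsWithin`. [cite: AroraBarak2009, §1.2] -/
theorem length_le_of_tm2OutputsInTime (tm : FinTM2) {l : List (tm.Γ tm.k₀)}
    {l' : List (tm.Γ tm.k₁)} {m : ℕ} (h : TM2OutputsInTime tm l (some l') m) :
    l.length ≤ l'.length + machinePopBound tm * m := by
  obtain ⟨⟨n, hn⟩, hnm⟩ := h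
  have H := length_iterate_ge tm tm.k₀ n _ _ hn
  rw [haltList_eq, initList_eq] at H
  simp only [update_self] at H
  have H' := length_update_bot_le (Γ := tm.Γ) tm.k₁ tm.k₀ l'
  change n ≤ m at hnm
  have := Nat.mul_le_mul_left (machinePopBound tm) hnm
  omega

/-- The halting rule for `TM2ComputableAux.OutputsWithin` (alphabet-coded words). -/
private theorem length_input_le_of_outputsWithin {Γ₀ Γ₁ : Type} (M : TM2ComputableAux Γ₀ Γ₁)
    {l : List Γ₀} {l' : List Γ₁} {m : ℕ} (h : M.OutputsWithin l l' m) :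
    l.length ≤ l'.length + machinePopBound M.tm * m := by
  obtain ⟨h⟩ := h
  simpa only [List.length_map] using length_le_of_tm2OutputsInTime M.tm h

/-! ### Uniform time bounds space on runs -/

/-- **Uniform update/report time `T` forces space `D · T` on runs**, for a machine-dependent
constant `D` (the larger pop bound of the update and report machines): the update machine must
read `⟨bin N, ⟨σ, b⟩⟩ ⊇` a doubled copy of the state `σ`, the report machine `⟨bin N, σ_N⟩`.
[folklore] -/
theorem exists_length_reach_le_mul {A : StreamingAlgorithm} {T : ℕ → ℕ}
    (hU : HasUniformUpdateTime A T) (hR : HasUniformReportTime A T) :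
    ∃ D : ℕ, ∀ (N : ℕ) (x : List Bool), x.length ≤ N → (reach A N x).length ≤ D * T N := by
  obtain ⟨MU, hMU⟩ := hU
  obtain ⟨MR, hMR⟩ := hR
  refine ⟨max (machinePopBound MU.tm) (machinePopBound MR.tm), fun N => ?_⟩
  have hDU : machinePopBound MU.tm * T N ≤
      max (machinePopBound MU.tm) (machinePopBound MR.tm) * T N :=
    Nat.mul_le_mul_right _ (le_max_left _ _)
  have hDR : machinePopBound MR.tm * T N ≤
      max (machinePopBound MU.tm) (machinePopBound MR.tm) * T N :=
    Nat.mul_le_mul_right _ (le_max_right _ _)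
  -- downward induction on the number `j` of bits still to come
  suffices h : ∀ (j : ℕ) (x : List Bool), x.length + j = N →
      (reach A N x).length ≤ max (machinePopBound MU.tm) (machinePopBound MR.tm) * T N by
    intro x hx
    exact h (N - x.length) x (by omega)
  intro j
  induction j with
  | zero =>
    intro x hx
    rw [Nat.add_zero] at hx
    subst hx
    -- the report machine reads `⟨bin |x|, finalState x⟩`
    have h := length_input_le_of_outputsWithin MR (hMR x)
    rw [length_boolPair, List.length_singleton, finalState_eq_reach] at h
    omega
  | succ j ih =>
    intro x hx
    have hlt : x.length < N := by omega
    -- the update machine reads `⟨bin N, ⟨reach x, b⟩⟩` and writes `reach (x ++ [b])`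
    have h := length_input_le_of_outputsWithin MU (hMU N x false hlt)
    rw [length_boolPair, length_boolPair, List.length_singleton] at h
    have h2 := ih (x ++ [false]) (by rw [List.length_append, List.length_singleton]; omega)
    omega

/-- The same, phrased with the tree's `RunsInSpace`: uniform time `T` gives space `D · T` on runs.
[folklore] -/
theorem exists_runsInSpace_mul_of_uniformTime {A : StreamingAlgorithm} {T : ℕ → ℕ}
    (hU : HasUniformUpdateTime A T) (hR : HasUniformReportTime A T) :
    ∃ D : ℕ, RunsInSpace A (fun N => D * T N) :=
  exists_length_reach_le_mul hU hR

/-- **`USTREAM S T ⊆ ⋃_D USTREAM (D · T) T`**: in the uniform class the space parameter can always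
be replaced by a constant multiple of the time parameter. [folklore] -/
theorem USTREAM_subset_iUnion_USTREAM_mul (S T : ℕ → ℕ) :
    USTREAM S T ⊆ ⋃ D : ℕ, USTREAM (fun N => D * T N) T := by
  rintro L ⟨A, h0, -, hU, hR, hD⟩
  obtain ⟨D, hS⟩ := exists_runsInSpace_mul_of_uniformTime hU hR
  exact Set.mem_iUnion.2 ⟨D, A, h0, hS, hU, hR, hD⟩

/-! ### THEOREM F♭ -/

/-- **THEOREM F♭ (time-only fragment of the summit's streaming family).** If the update/report
time is sublinear — `C · T N < N` eventually, for every constant `C` — then `SAT ∉ USTREAM S T`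
for EVERY space bound `S`: the reached states have length `≤ D · T N` (halting rule), and
THEOREM F♯ excludes one-pass space below `N / 17`. [folklore (fooling set)] -/
theorem SAT_not_mem_USTREAM_of_sublinear_time {S T : ℕ → ℕ}
    (hT : ∀ C : ℕ, ∃ N₀, ∀ N ≥ N₀, C * T N < N) : SAT ∉ USTREAM S T := by
  rintro ⟨A, -, -, hU, hR, hD⟩
  obtain ⟨D, hS⟩ := exists_runsInSpace_mul_of_uniformTime hU hR
  obtain ⟨N₀, hN₀⟩ := hT (17 * D)
  have h : ∃ N₀, ∀ N ≥ N₀, (8 * 1 + 9) * (D * T N) < 1 * N :=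
    ⟨N₀, fun N hN => by
      have e : (8 * 1 + 9) * (D * T N) = 17 * D * T N := by ring
      rw [e, one_mul]
      exact hN₀ N hN⟩
  obtain ⟨k, c, hk⟩ := exists_foolLen_violation_rate (S := fun N => D * T N) le_rfl h
  exact Nat.lt_irrefl _ (Nat.lt_of_le_of_lt (mul_two_pow_le_space_of_decides_SAT hS hD k c) hk)

/-- THEOREM F♭ for polynomially-shaped sublinear time: `SAT ∉ USTREAM S (fun N => N / g N)` for any
`g → ∞` in the arithmetic form `∀ C, ∃ N₀, ∀ N ≥ N₀, C < g N` (e.g. `g = log`, `g N = N^ε`-type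
denominators), whatever `S`. [folklore (fooling set)] -/
theorem SAT_not_mem_USTREAM_div_of_tendsto {S : ℕ → ℕ} {g : ℕ → ℕ}
    (hg : ∀ C : ℕ, ∃ N₀, ∀ N ≥ N₀, C < g N) : SAT ∉ USTREAM S (fun N => N / g N) := by
  refine SAT_not_mem_USTREAM_of_sublinear_time fun C => ?_
  obtain ⟨N₀, hN₀⟩ := hg (C + 1)
  refine ⟨max N₀ 1, fun N hN => ?_⟩
  have hg' : C + 1 < g N := hN₀ N (le_trans (le_max_left _ _) hN)
  have hN1 : 1 ≤ N := le_trans (le_max_right _ _) hN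
  have hgpos : 0 < g N := by omega
  -- `C · (N / g) < N` since `C < g` and `N ≥ 1`
  have h1 : C * (N / g N) ≤ C * N / g N := Nat.mul_div_le_mul_div_assoc C N (g N)
  have h2 : C * N / g N < N := by
    rw [Nat.div_lt_iff_lt_mul hgpos]
    calc C * N < (C + 1) * N := by nlinarith
      _ ≤ N * g N := by rw [mul_comm]; exact Nat.mul_le_mul_left N hg'.le
  omega

/-- **The two decided strips of the `(S, T)`-plane.** `SAT ∉ USTREAM S T` as soon as EITHER the
space is below the entropy rate (`(8m+9) · S N < m · N` eventually, some `m ≥ 1`; THEOREM F♯) OR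
the time is sublinear (THEOREM F♭). [folklore (fooling set)] -/
theorem SAT_not_mem_USTREAM_of_rate_or_sublinear {S T : ℕ → ℕ}
    (h : (∃ m, 1 ≤ m ∧ ∃ N₀, ∀ N ≥ N₀, (8 * m + 9) * S N < m * N) ∨
      (∀ C : ℕ, ∃ N₀, ∀ N ≥ N₀, C * T N < N)) : SAT ∉ USTREAM S T := by
  rcases h with ⟨m, hm, hS⟩ | hT
  · exact SAT_not_mem_USTREAM_of_rate hm hS T
  · exact SAT_not_mem_USTREAM_of_sublinear_time hT

end Summit.PneNP.PneNP.Theorems.SoloBlind
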